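import Literature.Geometry.Riemannian.PerelmanNoncollapsingInterior
import Literature.Geometry.Riemannian.PerelmanNoncollapsingLinearParabolic
import HarnessLib

/-!
# Perelman's no local collapsing theorem from the linear heat equation with coefficients on a
# LARGER time interval (no boundary regularity): the interior conjugate heat flow

`PerelmanNoncollapsingInterior.lean` reduces the named fact `perelman_noLocalCollapsing`
(`CanonicalNeighbourhoods.lean`; Perelman 2002, §4, Thm. 4.1) to the monotonicity
`μ(g(b), τ + t₀ − b) ≤ μ(g(t₀), τ)` of Perelman's `μ` between INTERIOR times `0 < b < t₀ < T` of a
Ricci flow on `[0, T)` (`perelman_noLocalCollapsing_of_muMonotone_interior`). This file supplies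
that monotonicity from Perelman's entropy formula (proved in the tree) and the backward conjugate
heat flow on `[b, t₀]`, and the latter from the solvability of the LINEAR heat-type Cauchy problem
`∂ₛw = Δ_{h(s)} w − Q w`, `w(0) = w₀`, on `M × [0, T_w]` for data `(h, Q)` smooth on a STRICTLY
LARGER closed time interval `[a, c] ∋ [0, T_w]`, `a < 0 < T_w < c` (Topping 2006, Rem. 8.2.5:
"standard parabolic theory"): since `0 < b` and `t₀ < T`, the reversed flow `h(s) = g(t₀ − s)`
is smooth on `[t₀ − T₁, t₀] ⊋ [0, t₀ − b]` for any `T₁ ∈ (t₀, T)`. In this form the analytic input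
asks for NO regularity of the solution at an end of the coefficient interval — the form delivered
by interior (hypo)elliptic regularity (Hörmander 1967, Thm. 1.1, proved in the tree as
`Literature.Analysis.Hypoelliptic.hormander1967_thm11_proof`) once weak solutions exist.

* `IsRicciFlow.muEntropy_le_muEntropy_of_conjugateHeat_solvable` — **(8.3.10) for one flow on
  `[0, T']` from the bare backward solvability of `□*u = 0`** on a closed manifold modelled on
  `ℝ^m`: positivity (`IsRicciFlow.pos_of_isConjugateHeatSolutionOn`, Topping (6.4.8)),
  conservation of `∫ u dV` (`integral_conjugateHeat_eq_Icc`, Rem. 8.2.2), Perelman's entropy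
  formula in Topping's form `□*v ≤ 0` (`conjugateHeatOp_entropyIntegrand_nonpos`, Prop. 8.2.6)
  integrated (`monotoneOn_wEntropy_of_conjugateHeatOp_entropyIntegrand_nonpos`, Prop. 8.2.1), and
  `muEntropy_le_muEntropy_of_conjugateHeat`;
* `IsRicciFlow.muEntropy_le_muEntropy_interior` — **(8.3.10) between interior times `b < t₀`**
  of a flow on `[0, T)` from the backward solvability on `[b, t₀]` (time translation
  `IsRicciFlow.comp_add_const`);
* `IsRicciFlow.exists_isConjugateHeatSolutionOn_interior` — **the backward conjugate heat flow
  on `[b, t₀]` from the linear heat equation with data on a larger interval** (time reversal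
  `s = t₀ − t`, `h(s) = g(t₀ − s)`, `Q(s) = R(t₀ − s)` on `[t₀ − T₁, t₀]`, `T₁ = (t₀ + T)/2`);
* `perelman_noLocalCollapsing_of_linearHeat_interior` — **the named fact from the linear heat
  equation with coefficients on a larger time interval** (hypothesis `hLH`, over closed manifolds
  modelled on `ℝ^m`).

Everything is proved; no definition and no named fact is introduced; the named fact is NOT
discharged: `hLH` (existence AND smoothness on `M × [0, T_w]` of the solution of a linear
parabolic equation whose smooth coefficients live on `M × [a, c]`, `a < 0 < T_w < c`) is the only
remaining input.

## References

* G. Perelman, *The entropy formula for the Ricci flow and its geometric applications*,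
  arXiv:math/0211159 (2002), §3.1, (3.4); §4, Thm. 4.1. [Perelman2002]
* P. Topping, *Lectures on the Ricci flow*, LMS Lecture Note Series 325, CUP 2006, §6.4 (6.4.8),
  §8.2, Prop. 8.2.1, Rem. 8.2.2, Rem. 8.2.5, Prop. 8.2.6; §8.3, Thm. 8.3.1, (8.3.10). [Topping2006]
* L. Hörmander, *Hypoelliptic second order differential equations*, Acta Math. 119 (1967),
  Thm. 1.1. [Hormander1967]
-/

noncomputable section

open Set Function Filter Manifold Bundle MeasureTheory Module
open scoped Manifold ContDiff Topology

namespace Literature.Geometry.Riemannian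

open Lorentzian Lorentzian.PseudoRiemannianMetric

universe u v w

section OneFlow

variable {m : ℕ} {H : Type v} [TopologicalSpace H]
  {I : ModelWithCorners ℝ (EuclideanSpace ℝ (Fin m)) H} [I.Boundaryless]
  {M : Type w} [TopologicalSpace M] [ChartedSpace H M] [IsManifold I ∞ M]
  [T2Space M] [CompactSpace M] [MeasurableSpace M] [BorelSpace M]
  {g : ℝ → PseudoRiemannianMetric I ∞ (EuclideanSpace ℝ (Fin m)) (TangentSpace I : M → Type _)}
  {cov : ℝ → CovariantDerivative I (EuclideanSpace ℝ (Fin m)) (TangentSpace I : M → Type _)}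

/-- **Topping's (8.3.10) for one flow from the bare backward solvability of `□*u = 0`.** For a
Ricci flow of Riemannian metrics `(g, cov)` on `[0, T']`, `T' > 0`, on a closed manifold modelled on
`ℝ^m`: if every smooth positive `u₁` is the value at `T'` of a conjugate heat solution `u` on
`M × [0, T']` (`IsConjugateHeatSolutionOn`; no positivity asked), then
`μ(g(0), τ + T') ≤ μ(g(T'), τ)` for every `τ > 0`. Positivity of `u` is automatic
(`IsRicciFlow.pos_of_isConjugateHeatSolutionOn`), `∫ u dV` is conserved
(`integral_conjugateHeat_eq_Icc`) and `𝒲` is monotone by Perelman's entropy formula in Topping's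
form (`conjugateHeatOp_entropyIntegrand_nonpos`,
`monotoneOn_wEntropy_of_conjugateHeatOp_entropyIntegrand_nonpos`); conclude by
`muEntropy_le_muEntropy_of_conjugateHeat`.
[cite: Topping2006, §8.3, (8.3.10); §8.2, Prop. 8.2.1, Rem. 8.2.2, Prop. 8.2.6] [cite: Perelman2002, §3.1, (3.4)] -/
theorem IsRicciFlow.muEntropy_le_muEntropy_of_conjugateHeat_solvable {T' : ℝ} (hT' : 0 < T')
    (h : IsRicciFlow g cov (Icc 0 T')) (hR : ∀ t ∈ Icc 0 T', (g t).IsRiemannian)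
    (hCH : ∀ u₁ : M → ℝ, ContMDiff I 𝓘(ℝ, ℝ) ∞ u₁ → (∀ x, 0 < u₁ x) →
      ∃ u : ℝ → M → ℝ, u T' = u₁ ∧ IsConjugateHeatSolutionOn g cov (Icc 0 T') u)
    {τ : ℝ} (hτ : 0 < τ) :
    (g 0).muEntropy (cov 0) (τ + T') ≤ (g T').muEntropy (cov T') τ := by
  have hm : (finrank ℝ (EuclideanSpace ℝ (Fin m)) : ℝ) = m := by simp
  have hnm : finrank ℝ (EuclideanSpace ℝ (Fin m)) = m := by simp
  refine muEntropy_le_muEntropy_of_conjugateHeat g cov hT' hτ ?_ ?_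
  · intro u₁ hu₁ hu₁p
    obtain ⟨u, huT, hsol⟩ := hCH u₁ hu₁ hu₁p
    have hpos := h.pos_of_isConjugateHeatSolutionOn hT' hR hsol (by rw [huT]; exact hu₁p)
    exact ⟨u, huT, hpos, hsol.1, hsol.2⟩
  · intro u hpos hsmooth hpde
    refine ⟨fun t ht ↦ h.integral_conjugateHeat_eq_Icc hT' hR hsmooth hpde ht, ?_⟩
    have key := h.monotoneOn_wEntropy_of_conjugateHeatOp_entropyIntegrand_nonpos hT' hR hτ hpos
      hsmooth (fun t ht x ↦ h.conjugateHeatOp_entropyIntegrand_nonpos hT' hR hpos ⟨hsmooth, hpde⟩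
        hnm (by linarith) ht x)
    rw [hm]
    exact key

/-- **(8.3.10) between interior times.** For a Ricci flow of Riemannian metrics on `[0, T)` on a
closed manifold modelled on `ℝ^m` and `0 < b < t₀ < T`: if the conjugate heat equation of the
translated flow `t ↦ g(t + b)` is solvable backwards on `[0, t₀ − b]` from every smooth positive
final datum, then `μ(g(b), τ + (t₀ − b)) ≤ μ(g(t₀), τ)` for every `τ > 0`
(`muEntropy_le_muEntropy_of_conjugateHeat_solvable` for the translated flow,
`IsRicciFlow.comp_add_const`). [cite: Topping2006, §8.3, (8.3.10)] -/
theorem IsRicciFlow.muEntropy_le_muEntropy_interior {T : ℝ} (h : IsRicciFlow g cov (Ico 0 T))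
    (hR : ∀ t ∈ Ico 0 T, (g t).IsRiemannian) {b t₀ : ℝ} (hb : 0 < b) (hbt : b < t₀) (ht₀ : t₀ < T)
    (hCH : ∀ u₁ : M → ℝ, ContMDiff I 𝓘(ℝ, ℝ) ∞ u₁ → (∀ x, 0 < u₁ x) →
      ∃ u : ℝ → M → ℝ, u (t₀ - b) = u₁ ∧
        IsConjugateHeatSolutionOn (fun t ↦ g (t + b)) (fun t ↦ cov (t + b)) (Icc 0 (t₀ - b)) u)
    {τ : ℝ} (hτ : 0 < τ) :
    (g b).muEntropy (cov b) (τ + (t₀ - b)) ≤ (g t₀).muEntropy (cov t₀) τ := by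
  have hsub : Icc 0 (t₀ - b) ⊆ (· + b) ⁻¹' Ico 0 T := fun t ht ↦
    ⟨by simp only; linarith [ht.1], by simp only; linarith [ht.2]⟩
  have hflow : IsRicciFlow (fun t ↦ g (t + b)) (fun t ↦ cov (t + b)) (Icc 0 (t₀ - b)) :=
    (h.comp_add_const b).mono hsub
  have hRiem : ∀ t ∈ Icc 0 (t₀ - b), (g (t + b)).IsRiemannian := fun t ht ↦ hR _ (hsub ht)
  have key := hflow.muEntropy_le_muEntropy_of_conjugateHeat_solvable (sub_pos.2 hbt) hRiem hCH hτ
  simp only [zero_add, sub_add_cancel] at key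
  exact key

omit [T2Space M] [CompactSpace M] [MeasurableSpace M] [BorelSpace M] in
/-- **The backward conjugate heat flow between interior times from the linear heat equation with
coefficients on a larger interval** (Topping 2006, Rem. 8.2.5 with §6.4, (6.4.7)–(6.4.8), time
reversed). Let `(g, cov)` be a Ricci flow of Riemannian metrics on `[0, T)` on a closed manifold
modelled on `ℝ^m`, `0 < b < t₀ < T`. Assume `hLH` for this manifold: for all `a < 0 < T_w < c`,
every family `h` of Riemannian metrics smooth on `M × [a, c]`, every `Q` smooth on `M × [a, c]`
and every smooth `w₀` there is `w` smooth on `M × [0, T_w]` with `w(0) = w₀` and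
`∂ₛw = Δ_{h(s)}w − Qw` on `[0, T_w]` (one-sided `derivWithin`). Then every smooth positive `u₁`
is the value at `t₀ − b` of a conjugate heat solution of the translated flow `t ↦ g(t + b)` on
`[0, t₀ − b]`: with `T₁ = (t₀ + T)/2`, solve for `h(s) = g(t₀ − s)`, `Q(s) = R(t₀ − s)` on
`[t₀ − T₁, t₀] ∋ [0, t₀ − b]` and put `u(t) = w(t₀ − b − t)`.
[cite: Topping2006, §8.2, Rem. 8.2.5; §6.4, (6.4.7)–(6.4.8)] -/
theorem IsRicciFlow.exists_isConjugateHeatSolutionOn_interior {T : ℝ}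
    (hflow : IsRicciFlow g cov (Ico 0 T)) (hR : ∀ t ∈ Ico 0 T, (g t).IsRiemannian) {b t₀ : ℝ}
    (hb : 0 < b) (hbt : b < t₀) (ht₀ : t₀ < T)
    (hLH : ∀ (a c T_w : ℝ), a < 0 → 0 < T_w → T_w < c →
      ∀ h : ℝ → PseudoRiemannianMetric I ∞ (EuclideanSpace ℝ (Fin m)) (TangentSpace I : M → Type _),
        IsContMDiffFamilyOn ∞ h (Icc a c) → (∀ s ∈ Icc a c, (h s).IsRiemannian) →
        ∀ Q : ℝ → M → ℝ,
          ContMDiffOn (I.prod 𝓘(ℝ, ℝ)) 𝓘(ℝ, ℝ) ∞ (fun p : M × ℝ ↦ Q p.2 p.1) (univ ×ˢ Icc a c) →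
        ∀ w₀ : M → ℝ, ContMDiff I 𝓘(ℝ, ℝ) ∞ w₀ →
          ∃ w : ℝ → M → ℝ, w 0 = w₀ ∧
            ContMDiffOn (I.prod 𝓘(ℝ, ℝ)) 𝓘(ℝ, ℝ) ∞ (fun p : M × ℝ ↦ w p.2 p.1)
              (univ ×ˢ Icc 0 T_w) ∧
            ∀ s ∈ Icc 0 T_w, ∀ x, derivWithin (fun r ↦ w r x) (Icc 0 T_w) s =
              (h s).laplaceBeltrami (w s) x - Q s x * w s x)
    (u₁ : M → ℝ) (hu₁ : ContMDiff I 𝓘(ℝ, ℝ) ∞ u₁) :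
    ∃ u : ℝ → M → ℝ, u (t₀ - b) = u₁ ∧
      IsConjugateHeatSolutionOn (fun t ↦ g (t + b)) (fun t ↦ cov (t + b)) (Icc 0 (t₀ - b)) u := by
  -- the larger coefficient interval `[t₀ - T₁, t₀]`, `T₁ = (t₀ + T)/2`, image of `[0, T₁]`
  set T₁ : ℝ := (t₀ + T) / 2 with hT₁
  have hT₁t : t₀ < T₁ := by rw [hT₁]; linarith
  have hT₁T : T₁ < T := by rw [hT₁]; linarith
  have hT₁0 : 0 < T₁ := (hb.trans hbt).trans hT₁t
  have hsub₁ : Icc 0 T₁ ⊆ Ico 0 T := Icc_subset_Ico_right hT₁T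
  have hflow₁ : IsRicciFlow g cov (Icc 0 T₁) := hflow.mono hsub₁
  have hmaps : ∀ s ∈ Icc (t₀ - T₁) t₀, t₀ - s ∈ Icc (0 : ℝ) T₁ := fun s hs ↦
    ⟨by linarith [hs.2], by linarith [hs.1]⟩
  -- the time reversal `(x, s) ↦ (x, t₀ - s)` of `M × ℝ`
  have hρ : ContMDiff (I.prod 𝓘(ℝ, ℝ)) (I.prod 𝓘(ℝ, ℝ)) ∞ (fun p : M × ℝ ↦ (p.1, t₀ - p.2)) :=
    contMDiff_fst.prodMk ((contDiff_const.sub contDiff_id).contMDiff.comp contMDiff_snd)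
  have hρmaps : MapsTo (fun p : M × ℝ ↦ (p.1, t₀ - p.2)) (univ ×ˢ Icc (t₀ - T₁) t₀)
      (univ ×ˢ Icc (0 : ℝ) T₁) := fun p hp ↦ ⟨mem_univ _, hmaps p.2 hp.2⟩
  -- the reversed family `h(s) = g(t₀ - s)` is smooth on `M × [t₀ - T₁, t₀]` and Riemannian
  have hfam : IsContMDiffFamilyOn ∞ (fun s ↦ g (t₀ - s)) (Icc (t₀ - T₁) t₀) := by
    have h1 := hflow₁.smooth.comp_affine (-1) t₀
    have hset : (fun t : ℝ ↦ (-1) * t + t₀) ⁻¹' Icc 0 T₁ = Icc (t₀ - T₁) t₀ := by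
      ext s
      simp only [mem_preimage, mem_Icc]
      constructor <;> rintro ⟨h₁, h₂⟩ <;> constructor <;> linarith
    have hfun : (fun s : ℝ ↦ g ((-1) * s + t₀)) = fun s ↦ g (t₀ - s) := by
      funext s
      congr 1
      ring
    rw [hset, hfun] at h1
    exact h1
  have hRiem' : ∀ s ∈ Icc (t₀ - T₁) t₀, (g (t₀ - s)).IsRiemannian := fun s hs ↦
    hR _ (hsub₁ (hmaps s hs))
  -- the potential `Q(s) = R(t₀ - s)` is smooth on `M × [t₀ - T₁, t₀]`
  have hQ : ContMDiffOn (I.prod 𝓘(ℝ, ℝ)) 𝓘(ℝ, ℝ) ∞ (fun p : M × ℝ ↦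
      (fun (s : ℝ) (x : M) ↦ (g (t₀ - s)).scalarCurvatureWith (cov (t₀ - s)) x) p.2 p.1)
      (univ ×ˢ Icc (t₀ - T₁) t₀) :=
    hflow₁.contMDiffOn_scalarCurvatureWith.comp hρ.contMDiffOn hρmaps
  -- solve the forward linear equation on `[0, t₀ - b]` from `u₁`
  have ha : t₀ - T₁ < 0 := by linarith
  have hTw : 0 < t₀ - b := sub_pos.2 hbt
  have hc : t₀ - b < t₀ := by linarith
  obtain ⟨w, hw0, hw, hwpde⟩ := hLH (t₀ - T₁) t₀ (t₀ - b) ha hTw hc (fun s ↦ g (t₀ - s)) hfam hRiem'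
    (fun (s : ℝ) (x : M) ↦ (g (t₀ - s)).scalarCurvatureWith (cov (t₀ - s)) x) hQ u₁ hu₁
  -- `u(t) = w(t₀ - b - t)` on the translated time axis
  have hmaps' : ∀ t ∈ Icc (0 : ℝ) (t₀ - b), t₀ - b - t ∈ Icc (0 : ℝ) (t₀ - b) := fun t ht ↦
    ⟨by linarith [ht.2], by linarith [ht.1]⟩
  have hρ' : ContMDiff (I.prod 𝓘(ℝ, ℝ)) (I.prod 𝓘(ℝ, ℝ)) ∞ (fun p : M × ℝ ↦ (p.1, t₀ - b - p.2)) :=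
    contMDiff_fst.prodMk ((contDiff_const.sub contDiff_id).contMDiff.comp contMDiff_snd)
  have hρ'maps : MapsTo (fun p : M × ℝ ↦ (p.1, t₀ - b - p.2)) (univ ×ˢ Icc (0 : ℝ) (t₀ - b))
      (univ ×ˢ Icc (0 : ℝ) (t₀ - b)) := fun p hp ↦ ⟨mem_univ _, hmaps' p.2 hp.2⟩
  refine ⟨fun t x ↦ w (t₀ - b - t) x, ?_, ?_, ?_⟩
  · funext x
    simp only [sub_self, hw0]
  · exact hw.comp hρ'.contMDiffOn hρ'maps
  · intro t ht x
    have hd := hasDerivWithinAt_time (n := ∞) (by simp) hw x (hmaps' t ht)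
    rw [hwpde (t₀ - b - t) (hmaps' t ht) x] at hd
    have hrev := hasDerivWithinAt_time_reverse (T' := t₀ - b) (s := t) hd
    rw [hrev.derivWithin (uniqueDiffOn_Icc hTw t ht)]
    have e1 : t₀ - (t₀ - b - t) = t + b := by ring
    simp only [e1]
    ring

end OneFlow

/-! ### The named fact from the linear heat equation with coefficients on a larger interval -/

/-- **Perelman's no local collapsing theorem I from the existence of smooth solutions of the
linear heat equation with smooth coefficients on a larger time interval** (Perelman 2002, §4,
Thm. 4.1; Topping 2006, Rem. 8.2.5, Thm. 8.3.1). Hypothesis `hLH`: on every closed manifold `M`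
modelled on `EuclideanSpace ℝ (Fin m)` (all `m`; boundaryless model, any Borel structure), for all
reals `a < 0 < T < c`, every family `h` of Riemannian metrics smooth on `M × [a, c]`
(`IsContMDiffFamilyOn ∞ h (Icc a c)`), every `Q : ℝ → M → ℝ` smooth on `M × [a, c]` and every
smooth `w₀`, there is `w : ℝ → M → ℝ`, smooth on `M × [0, T]`, with `w(0) = w₀` and
`∂ₛw(s, x) = Δ_{h(s)} w(s)(x) − Q(s, x) w(s, x)` for all `(x, s) ∈ M × [0, T]` (`∂ₛ` the one-sided
`derivWithin` in `[0, T]`, which for a `w` smooth on a neighbourhood of `M × [0, T]` is the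
ordinary derivative). The coefficients live on the LARGER interval `[a, c]`, so no regularity of
`w` at an end of the coefficient interval is demanded. Conclusion: `perelman_noLocalCollapsing` in
full generality (`perelman_noLocalCollapsing_of_muMonotone_interior`,
`IsRicciFlow.muEntropy_le_muEntropy_interior`, `IsRicciFlow.exists_isConjugateHeatSolutionOn_interior`).
NOT a discharge of the named fact: `hLH` is the standard existence-and-regularity theorem for
linear parabolic equations on closed manifolds (Topping 2006, Rem. 8.2.5), absent from Mathlib.
[cite: Perelman2002, §4, Thm. 4.1] [cite: Topping2006, §8.2, Rem. 8.2.5; §8.3, Thm. 8.3.1] -/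
theorem perelman_noLocalCollapsing_of_linearHeat_interior
    (hLH : ∀ (m : ℕ) {H : Type v} [TopologicalSpace H]
      (I : ModelWithCorners ℝ (EuclideanSpace ℝ (Fin m)) H) [I.Boundaryless]
      (M : Type w) [TopologicalSpace M] [T2Space M] [SecondCountableTopology M] [CompactSpace M]
      [ChartedSpace H M] [IsManifold I ∞ M] [MeasurableSpace M] [BorelSpace M]
      (a c T : ℝ), a < 0 → 0 < T → T < c →
      ∀ h : ℝ → PseudoRiemannianMetric I ∞ (EuclideanSpace ℝ (Fin m)) (TangentSpace I : M → Type _),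
        IsContMDiffFamilyOn ∞ h (Icc a c) → (∀ s ∈ Icc a c, (h s).IsRiemannian) →
        ∀ Q : ℝ → M → ℝ,
          ContMDiffOn (I.prod 𝓘(ℝ, ℝ)) 𝓘(ℝ, ℝ) ∞ (fun p : M × ℝ ↦ Q p.2 p.1) (univ ×ˢ Icc a c) →
        ∀ w₀ : M → ℝ, ContMDiff I 𝓘(ℝ, ℝ) ∞ w₀ →
          ∃ w : ℝ → M → ℝ, w 0 = w₀ ∧
            ContMDiffOn (I.prod 𝓘(ℝ, ℝ)) 𝓘(ℝ, ℝ) ∞ (fun p : M × ℝ ↦ w p.2 p.1) (univ ×ˢ Icc 0 T) ∧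
            ∀ s ∈ Icc 0 T, ∀ x, derivWithin (fun r ↦ w r x) (Icc 0 T) s =
              (h s).laplaceBeltrami (w s) x - Q s x * w s x) :
    perelman_noLocalCollapsing.{u, v, w} :=
  perelman_noLocalCollapsing_of_muMonotone_interior
    fun m _H _ I _ M _ _ _ _ _ _ _ _ _ _ _ _ hflow hRiem _ _ hb hbt ht₀T _ hτ ↦
      hflow.muEntropy_le_muEntropy_interior hRiem hb hbt ht₀T
        (fun u₁ hu₁ _ ↦ hflow.exists_isConjugateHeatSolutionOn_interior hRiem hb hbt ht₀T
          (hLH m I M) u₁ hu₁) hτ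

end Literature.Geometry.Riemannian

end
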